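import Summits.Ventures.LatticeQCDFlow.Exactness.Phi4HMCCarreDuChamp
import Summits.Ventures.LatticeQCDFlow.Exactness.InvolutiveMetropolisEnergyBound
import Summits.Ventures.LatticeQCDFlow.Exactness.HMCMomentumMoments
import Summits.Ventures.LatticeQCDFlow.Exactness.Phi4HMCEnergyViolationIntegrable
import Summits.Ventures.LatticeQCDFlow.Exactness.Phi4MetropolisCSDFloor
import HarnessLib

/-!
# HMC moves the magnetisation by `δ ×` the trapezoidal sum of the total momentum; the ONE-STEP floor `τ_int(f(M)) ≥ 2 Var(f(M))/(V δ²) − ½`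

HONEST FRAMING: exact (Metropolis-corrected) sampling algorithms for lattice gauge theory;
figures of merit are autocorrelation/cost numbers at stated couplings and volumes; no
continuum-physics claim.  (SCALAR calibration rung S0-A: not a gauge result.)

Venture `LatticeQCDFlow` (cell pub-lqcd), topic `Exactness`; FANOUT row 2 (`s0-phi4`, HMC arm — the
row's "dynamical exponents z" deliverable from the side of THEOREMS).  NEW WORK of the cell,
composing `Phi4HMCCarreDuChamp` (`τ_int ≥ 2 Var(f)/⟨(Δf)²⟩_acc − ½` for every HMC-type update),
`InvolutiveMetropolisEnergyBound.integral_involAccept_mul_comp_le` (accepted-endpoint domination)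
and `HMCMomentumMoments` (`⟨(Σ_x p_x)²⟩ = V`).  Nothing is cited as a fact.  Printed neighbours,
NAMED ONLY: Kennedy–Pendleton 2001 (NPB 607:456, free field: "HMC and L2MC have the same volume
dependence, but their dynamical critical exponents are z = 1 and z = 3/2"; the Langevin limit of
one-step trajectories is their §8 discussion); the physics reading "single-step HMC is a local
(diffusive) algorithm" is folklore.

## What is proved (`Λ = Fin (n+1)`, `V = n+1`, qpq leapfrog `leapfrogQPQ J λ δ`, `P(p) = Σ_x p_x`)

* **`sum_fst_leapfrogQPQ_sub`** — ONE qpq step moves the magnetisation by the mean of the total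
  momenta before and after: `Σ_x q'_x − Σ_x q_x = (δ/2)(P(p) + P(p'))`;
  **`sum_fst_leapfrogQPQ_iterate_sub`** — along `N` steps, the trapezoidal rule:
  `Σ_x (q_N)_x − Σ_x (q_0)_x = (δ/2) Σ_{k<N} (P(p_k) + P(p_{k+1}))` (the TOTAL-MOMENTUM PATH formula:
  HMC moves `M` by `δ` times the trapezoidal sum of the total momentum along the trajectory);
* `sum_fst_hmcProposal_one_sub` — for the one-step proposal `Ψ₁ = flip ∘ leapfrog`:
  `M((Ψ₁ z).1) − M(z.1) = (δ/2)(P(z.2) − P((Ψ₁ z).2))` (both momenta are ENDPOINT momenta);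
* `integrable_totalSq_mul_exp_neg`, `integral_totalSq_mul_exp_neg` — `∫∫ P(p)² e^{−H} = Z · V · Z_p`;
* **`hmc_oneStep_msd_le`** — for every `f` with `|f ψ − f φ| ≤ |Σψ − Σφ|`:
  `∫∫ a (f((Ψ₁ z).1) − f(z.1))² e^{−H} ≤ V δ² · Z_p Z` (Cauchy on the two endpoint momenta; the
  accepted-endpoint law of `P²` is dominated by its equilibrium law, mean `V`);
* **`hmcPhi4_oneStep_tauInt_ge`**, **`hmcPhi4_oneStep_tauInt_ge_clipMag`** — `λ > 0`, any `J`, every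
  step size `δ`, `N = 1`, `f` bounded measurable and 1-Lipschitz in `M` (instance the clipped
  magnetisation at every clip level), `g = f − ⟨f⟩`: summable autocorrelations with `ρ_g(1) < 1` ⇒
  `τ_int(f) ≥ 2 ⟨(f − ⟨f⟩)²⟩ / ((n+1) δ²) − ½` per update.

Reading (no numerics implied).  One-step HMC (the Langevin / smart-Monte-Carlo corner of the family;
one force evaluation per site per update, the cost of a sweep) cannot decorrelate the magnetisation
faster than `2χ/δ² − ½` updates, `χ = Var(M)/V`: the local arm's law (`Phi4MetropolisCSDFloorSecondMoment`:
`2χ/m₂ − ½` sweeps) with the leapfrog step in the place of the proposal width — `z_int,M ≥ γ/ν` for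
this corner too.  For `N ≥ 2` the path formula holds but the INTERMEDIATE total momenta are not
controlled by the endpoint identity, and no explicit floor is claimed (the free-field law, where the
zero mode rotates rigidly, is `1/(1 − cos(ω₀ N δ)) − ½ ≈ 2χ/(Nδ)²`; `Scoring/FreeFieldHMCAutocorrelation`).
NOT CLAIMED: `ρ_g(1) < 1` / summability for any run; the unclipped `M`; the pqp variant (its one-step
displacement carries a force term); any value of `χ`.
-/

namespace Summit.Ventures.LatticeQCDFlow.Exactness

open Real MeasureTheory Filter Finset
open Summit.Ventures.LatticeQCDFlow.Scoring

section OneStep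

variable {n : ℕ}

/-- **One qpq step moves the magnetisation by the mean of the total momenta before and after**:
`Σ_x (leapfrog z).1_x − Σ_x z.1_x = (δ/2)(Σ_x z.2_x + Σ_x (leapfrog z).2_x)`. -/
theorem sum_fst_leapfrogQPQ_sub (J : Fin (n + 1) → Fin (n + 1) → ℝ) (lam δ : ℝ)
    (z : (Fin (n + 1) → ℝ) × (Fin (n + 1) → ℝ)) :
    (∑ x, (leapfrogQPQ J lam δ z).1 x) - ∑ x, z.1 x
      = δ / 2 * ((∑ x, z.2 x) + ∑ x, (leapfrogQPQ J lam δ z).2 x) := by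
  have h : ∀ x, (leapfrogQPQ J lam δ z).1 x - z.1 x
      = δ / 2 * (z.2 x + (leapfrogQPQ J lam δ z).2 x) := by
    intro x
    simp only [leapfrogQPQ, lfDrift, lfKick]
    ring
  rw [← Finset.sum_sub_distrib, ← Finset.sum_add_distrib, Finset.mul_sum]
  exact Finset.sum_congr rfl fun x _ => h x

/-- **THE TOTAL-MOMENTUM PATH FORMULA** (trapezoidal rule): along `N` qpq steps
`Σ_x (q_N)_x − Σ_x (q_0)_x = (δ/2) Σ_{k<N} (P(p_k) + P(p_{k+1}))`, `P(p) = Σ_x p_x`,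
`(q_k, p_k) = leapfrog^k (q_0, p_0)`. -/
theorem sum_fst_leapfrogQPQ_iterate_sub (J : Fin (n + 1) → Fin (n + 1) → ℝ) (lam δ : ℝ)
    (z : (Fin (n + 1) → ℝ) × (Fin (n + 1) → ℝ)) :
    ∀ N : ℕ, (∑ x, ((leapfrogQPQ J lam δ)^[N] z).1 x) - ∑ x, z.1 x
      = δ / 2 * ∑ k ∈ Finset.range N,
          ((∑ x, ((leapfrogQPQ J lam δ)^[k] z).2 x) + ∑ x, ((leapfrogQPQ J lam δ)^[k + 1] z).2 x)
  | 0 => by simp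
  | N + 1 => by
    have ih := sum_fst_leapfrogQPQ_iterate_sub J lam δ z N
    have hstep := sum_fst_leapfrogQPQ_sub J lam δ ((leapfrogQPQ J lam δ)^[N] z)
    rw [Finset.sum_range_succ, mul_add, ← ih, Function.iterate_succ_apply']
    linarith

/-- **The one-step proposal moves `M` by `(δ/2)(P(start) − P(end))`**, both ENDPOINT momenta
(`Ψ₁ = flip ∘ leapfrog`, so `(Ψ₁ z).2 = −p'`):
`Σ_x (Ψ₁ z).1_x − Σ_x z.1_x = (δ/2)(Σ_x z.2_x − Σ_x (Ψ₁ z).2_x)`. -/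
theorem sum_fst_hmcProposal_one_sub (J : Fin (n + 1) → Fin (n + 1) → ℝ) (lam δ : ℝ)
    (z : (Fin (n + 1) → ℝ) × (Fin (n + 1) → ℝ)) :
    (∑ x, (hmcProposal J lam δ 1 z).1 x) - ∑ x, z.1 x
      = δ / 2 * ((∑ x, z.2 x) - ∑ x, (hmcProposal J lam δ 1 z).2 x) := by
  have h1 : (hmcProposal J lam δ 1 z).1 = (leapfrogQPQ J lam δ z).1 := by
    simp [hmcProposal, momFlip]
  have h2 : ∀ x, (hmcProposal J lam δ 1 z).2 x = -(leapfrogQPQ J lam δ z).2 x := by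
    intro x
    simp [hmcProposal, momFlip]
  simp only [h1, h2, Finset.sum_neg_distrib, sub_neg_eq_add]
  exact sum_fst_leapfrogQPQ_sub J lam δ z

/-- `P(p)² e^{−H}` is integrable on phase space (coercive action): `P² ≤ V Σp² ≤ V s(z)`. -/
theorem integrable_totalSq_mul_exp_neg {J : Fin (n + 1) → Fin (n + 1) → ℝ} {lam ε K : ℝ}
    (hε : 0 < ε) (hS : ∀ φ : Fin (n + 1) → ℝ, ε * ∑ w, φ w ^ 2 - K ≤ latticePhi4Action J lam φ) :
    Integrable (fun z : (Fin (n + 1) → ℝ) × (Fin (n + 1) → ℝ) =>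
      (∑ x, z.2 x) ^ 2 * Real.exp (-phi4HmcEnergy J lam z))
      ((volume : Measure (Fin (n + 1) → ℝ)).prod volume) := by
  have h := (integrable_phaseSize_pow_mul_exp_neg hε hS 0).const_mul ((n : ℝ) + 1)
  have hPm : Measurable fun z : (Fin (n + 1) → ℝ) × (Fin (n + 1) → ℝ) => ∑ x, z.2 x :=
    Finset.measurable_sum _ fun x _ => (measurable_pi_apply x).comp measurable_snd
  refine Integrable.mono' h ((hPm.pow_const 2).mul
    (Real.measurable_exp.comp (measurable_phi4HmcEnergy J lam).neg)).aestronglyMeasurable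
    (Eventually.of_forall fun z => ?_)
  have hw0 : 0 ≤ Real.exp (-phi4HmcEnergy J lam z) := (Real.exp_pos _).le
  rw [Real.norm_eq_abs, abs_mul, abs_of_nonneg (sq_nonneg _), abs_of_nonneg hw0]
  have hcs := sq_sum_le_card_mul_sum_sq (s := (Finset.univ : Finset (Fin (n + 1)))) (f := z.2)
  rw [Finset.card_univ, Fintype.card_fin] at hcs
  push_cast at hcs
  have hsz : ∑ x, z.2 x ^ 2 ≤ phaseSize z ^ (0 + 1) := by
    rw [zero_add, pow_one]
    exact sum_sq_snd_le_phaseSize z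
  have hV : (0 : ℝ) ≤ (n : ℝ) + 1 := by positivity
  calc (∑ x, z.2 x) ^ 2 * Real.exp (-phi4HmcEnergy J lam z)
      ≤ (((n : ℝ) + 1) * ∑ x, z.2 x ^ 2) * Real.exp (-phi4HmcEnergy J lam z) :=
        mul_le_mul_of_nonneg_right hcs hw0
    _ ≤ (((n : ℝ) + 1) * phaseSize z ^ (0 + 1)) * Real.exp (-phi4HmcEnergy J lam z) :=
        mul_le_mul_of_nonneg_right (mul_le_mul_of_nonneg_left hsz hV) hw0
    _ = ((n : ℝ) + 1) * (phaseSize z ^ (0 + 1) * Real.exp (-phi4HmcEnergy J lam z)) := by ring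

/-- **The total momentum carries `V` in mean square**: `∫∫ (Σ_x p_x)² e^{−H} = Z · (n+1) Z_p`. -/
theorem integral_totalSq_mul_exp_neg (J : Fin (n + 1) → Fin (n + 1) → ℝ) (lam : ℝ) :
    ∫ z : (Fin (n + 1) → ℝ) × (Fin (n + 1) → ℝ), (∑ x, z.2 x) ^ 2 * Real.exp (-phi4HmcEnergy J lam z)
        ∂((volume : Measure (Fin (n + 1) → ℝ)).prod volume)
      = gibbsZ J lam * (((n : ℝ) + 1) * momentumZ n) := by
  have e : ∀ z : (Fin (n + 1) → ℝ) × (Fin (n + 1) → ℝ),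
      (∑ x, z.2 x) ^ 2 * Real.exp (-phi4HmcEnergy J lam z)
      = gibbsWeight J lam z.1 * ((∑ x, z.2 x) ^ 2 * momentumWeight z.2) := by
    intro z
    rw [exp_neg_phi4HmcEnergy]
    ring
  simp_rw [e]
  rw [integral_prod_mul (f := gibbsWeight J lam)
    (g := fun p : Fin (n + 1) → ℝ => (∑ x, p x) ^ 2 * momentumWeight p),
    integral_totalSq_mul_momentumWeight]
  rfl

/-- **THE MEAN SQUARED ACCEPTED JUMP OF THE MAGNETISATION IN ONE-STEP HMC IS AT MOST `V δ²`** (in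
units of `Z_p Z`).  Coercive action, every `J`, `λ`, `δ`; `f` any observable with
`|f ψ − f φ| ≤ |Σ_x ψ_x − Σ_x φ_x|`:
`∫∫ a(z) (f((Ψ₁ z).1) − f(z.1))² e^{−H(z)} dz ≤ (n+1) δ² · Z_p · Z`. -/
theorem hmc_oneStep_msd_le {J : Fin (n + 1) → Fin (n + 1) → ℝ} {lam ε K : ℝ} (hε : 0 < ε)
    (hS : ∀ φ : Fin (n + 1) → ℝ, ε * ∑ w, φ w ^ 2 - K ≤ latticePhi4Action J lam φ) (δ : ℝ)
    {f : (Fin (n + 1) → ℝ) → ℝ}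
    (hfM : ∀ ψ φ : Fin (n + 1) → ℝ, |f ψ - f φ| ≤ |(∑ x, ψ x) - ∑ x, φ x|) :
    ∫ z, involAccept (phi4HmcEnergy J lam) (hmcProposal J lam δ 1) z
        * (f (hmcProposal J lam δ 1 z).1 - f z.1) ^ 2 * Real.exp (-phi4HmcEnergy J lam z)
          ∂((volume : Measure (Fin (n + 1) → ℝ)).prod volume)
      ≤ ((n : ℝ) + 1) * δ ^ 2 * (momentumZ n * gibbsZ J lam) := by
  set H := phi4HmcEnergy J lam with hH
  set Ψ := hmcProposal J lam δ 1 with hΨ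
  set G : (Fin (n + 1) → ℝ) × (Fin (n + 1) → ℝ) → ℝ := fun z => (∑ x, z.2 x) ^ 2 with hG
  have hΨm : Measurable Ψ := measurable_hmcProposal J lam δ 1
  have hΨi : Function.Involutive Ψ := hmcProposal_involutive J lam δ 1
  have hΨμ := measurePreserving_hmcProposal (Λ := Fin (n + 1)) J lam δ 1
  have hG0 : ∀ z, 0 ≤ G z := fun z => sq_nonneg _
  have hGw : Integrable (fun z => G z * Real.exp (-H z))
      ((volume : Measure (Fin (n + 1) → ℝ)).prod volume) := integrable_totalSq_mul_exp_neg hε hS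
  have hGΨ : Integrable (fun z => involAccept H Ψ z * G (Ψ z) * Real.exp (-H z))
      ((volume : Measure (Fin (n + 1) → ℝ)).prod volume) :=
    integrable_involAccept_comp_mul (measurable_phi4HmcEnergy J lam) hΨm hΨμ
      ((Finset.measurable_sum _ fun x _ => (measurable_pi_apply x).comp measurable_snd).pow_const 2) hGw
  -- pointwise: a (Δf)² ≤ (δ²/2) (P₀² + a P'²)
  have hpt : ∀ z, involAccept H Ψ z * (f (Ψ z).1 - f z.1) ^ 2 * Real.exp (-H z)
      ≤ δ ^ 2 / 2 * (G z * Real.exp (-H z))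
        + δ ^ 2 / 2 * (involAccept H Ψ z * G (Ψ z) * Real.exp (-H z)) := by
    intro z
    have ha0 := involAccept_nonneg H Ψ z
    have ha1 := involAccept_le_one H Ψ z
    have hw0 : 0 ≤ Real.exp (-H z) := (Real.exp_pos _).le
    have hdisp := sum_fst_hmcProposal_one_sub J lam δ z
    have hf2 : (f (Ψ z).1 - f z.1) ^ 2 ≤ ((∑ x, (Ψ z).1 x) - ∑ x, z.1 x) ^ 2 := by
      rw [← sq_abs, ← sq_abs ((∑ x, (Ψ z).1 x) - ∑ x, z.1 x)]
      exact pow_le_pow_left₀ (abs_nonneg _) (hfM _ _) 2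
    have hsq : ((∑ x, (Ψ z).1 x) - ∑ x, z.1 x) ^ 2 ≤ δ ^ 2 / 2 * (G z + G (Ψ z)) := by
      simp only [hΨ] at hdisp ⊢
      rw [hdisp]
      simp only [hG]
      nlinarith [sq_nonneg ((∑ x, z.2 x) + ∑ x, (hmcProposal J lam δ 1 z).2 x), sq_nonneg δ]
    have h1 : involAccept H Ψ z * (f (Ψ z).1 - f z.1) ^ 2
        ≤ involAccept H Ψ z * (δ ^ 2 / 2 * (G z + G (Ψ z))) :=
      mul_le_mul_of_nonneg_left (hf2.trans hsq) ha0
    have h2 : involAccept H Ψ z * (δ ^ 2 / 2 * G z) ≤ 1 * (δ ^ 2 / 2 * G z) :=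
      mul_le_mul_of_nonneg_right ha1 (by positivity)
    have h3 : involAccept H Ψ z * (f (Ψ z).1 - f z.1) ^ 2
        ≤ δ ^ 2 / 2 * G z + δ ^ 2 / 2 * (involAccept H Ψ z * G (Ψ z)) := by nlinarith [h1, h2]
    have h4 := mul_le_mul_of_nonneg_right h3 hw0
    calc _ ≤ (δ ^ 2 / 2 * G z + δ ^ 2 / 2 * (involAccept H Ψ z * G (Ψ z))) * Real.exp (-H z) := h4
      _ = _ := by ring
  have hR : Integrable (fun z => δ ^ 2 / 2 * (G z * Real.exp (-H z))
      + δ ^ 2 / 2 * (involAccept H Ψ z * G (Ψ z) * Real.exp (-H z)))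
      ((volume : Measure (Fin (n + 1) → ℝ)).prod volume) :=
    (hGw.const_mul _).add (hGΨ.const_mul _)
  have hmono : ∫ z, involAccept H Ψ z * (f (Ψ z).1 - f z.1) ^ 2 * Real.exp (-H z)
        ∂((volume : Measure (Fin (n + 1) → ℝ)).prod volume)
      ≤ ∫ z, (δ ^ 2 / 2 * (G z * Real.exp (-H z))
          + δ ^ 2 / 2 * (involAccept H Ψ z * G (Ψ z) * Real.exp (-H z)))
          ∂((volume : Measure (Fin (n + 1) → ℝ)).prod volume) :=
    integral_mono_of_nonneg (Eventually.of_forall fun z =>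
      mul_nonneg (mul_nonneg (involAccept_nonneg H Ψ z) (sq_nonneg _)) (Real.exp_pos _).le)
      hR (Eventually.of_forall hpt)
  rw [integral_add (hGw.const_mul _) (hGΨ.const_mul _), integral_const_mul, integral_const_mul]
    at hmono
  have hend := integral_involAccept_mul_comp_le (H := H) hΨm hΨi hΨμ hG0 hGw
  have hval : ∫ z, G z * Real.exp (-H z) ∂((volume : Measure (Fin (n + 1) → ℝ)).prod volume)
      = gibbsZ J lam * (((n : ℝ) + 1) * momentumZ n) := integral_totalSq_mul_exp_neg J lam
  rw [hval] at hmono hend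
  have hδ : 0 ≤ δ ^ 2 / 2 := by positivity
  calc _ ≤ δ ^ 2 / 2 * (gibbsZ J lam * (((n : ℝ) + 1) * momentumZ n))
        + δ ^ 2 / 2 * ∫ z, involAccept H Ψ z * G (Ψ z) * Real.exp (-H z)
          ∂((volume : Measure (Fin (n + 1) → ℝ)).prod volume) := hmono
    _ ≤ δ ^ 2 / 2 * (gibbsZ J lam * (((n : ℝ) + 1) * momentumZ n))
        + δ ^ 2 / 2 * (gibbsZ J lam * (((n : ℝ) + 1) * momentumZ n)) :=
          add_le_add le_rfl (mul_le_mul_of_nonneg_left hend hδ)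
    _ = ((n : ℝ) + 1) * δ ^ 2 * (momentumZ n * gibbsZ J lam) := by ring

/-- **THE ONE-STEP HMC FLOOR FOR MAGNETISATION-LIPSCHITZ OBSERVABLES.**  Lattice φ⁴, every `λ > 0`,
every real `J`, every step size `δ`, trajectory length `N = 1` (qpq); `f` bounded measurable with
`|f ψ − f φ| ≤ |Σψ − Σφ|`, `g = f − ⟨f⟩`.  Summable autocorrelations with `ρ_g(1) < 1` ⇒
`τ_int(f) = ½ + Σ_{k≥1} ρ_g(k) ≥ 2 ⟨(f − ⟨f⟩)²⟩ / ((n+1) δ²) − ½`  (per update). -/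
theorem hmcPhi4_oneStep_tauInt_ge {lam : ℝ} (hlam : 0 < lam) (J : Fin (n + 1) → Fin (n + 1) → ℝ)
    (δ : ℝ) {f : (Fin (n + 1) → ℝ) → ℝ} (hf : BddObs f)
    (hfM : ∀ ψ φ : Fin (n + 1) → ℝ, |f ψ - f φ| ≤ |(∑ x, ψ x) - ∑ x, φ x|)
    (hs : Summable fun k => (∫ φ, (f φ - gibbsExpect J lam f)
        * ((hmcOpPhi4 J lam δ 1)^[k + 1] (fun ψ => f ψ - gibbsExpect J lam f)) φ * gibbsWeight J lam φ)
        / ∫ φ, (f φ - gibbsExpect J lam f) ^ 2 * gibbsWeight J lam φ)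
    (hρ : (∫ φ, (f φ - gibbsExpect J lam f)
        * hmcOpPhi4 J lam δ 1 (fun ψ => f ψ - gibbsExpect J lam f) φ * gibbsWeight J lam φ)
        / (∫ φ, (f φ - gibbsExpect J lam f) ^ 2 * gibbsWeight J lam φ) < 1) :
    2 * gibbsExpect J lam (fun φ => (f φ - gibbsExpect J lam f) ^ 2) / (((n : ℝ) + 1) * δ ^ 2) - 1 / 2
      ≤ tauInt (fun k => (∫ φ, (f φ - gibbsExpect J lam f)
          * ((hmcOpPhi4 J lam δ 1)^[k] (fun ψ => f ψ - gibbsExpect J lam f)) φ * gibbsWeight J lam φ)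
          / ∫ φ, (f φ - gibbsExpect J lam f) ^ 2 * gibbsWeight J lam φ) :=
  hmcPhi4_tauInt_ge_of_msd_le hlam J δ 1 hf
    (hmc_oneStep_msd_le one_pos (latticePhi4Action_coercive hlam J) δ hfM) hs hρ

/-- The clipped magnetisation moves no more than the magnetisation, between ANY two configurations. -/
theorem clipMag_lipschitz_global (c : ℝ) (ψ φ : Fin (n + 1) → ℝ) :
    |max (-c) (min c (∑ x, ψ x)) - max (-c) (min c (∑ x, φ x))| ≤ |(∑ x, ψ x) - ∑ x, φ x| :=
  Literature.Analysis.FunctionSpaces.abs_clamp_sub_clamp_le c _ _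

/-- **THE ONE-STEP HMC FLOOR FOR THE CLIPPED MAGNETISATION.**  Every `λ > 0`, real `J`, step size
`δ`, clip level `c`; `f_c = max(−c, min(c, Σ_x φ_x))`, `g = f_c − ⟨f_c⟩`: summable autocorrelations
with `ρ_g(1) < 1` ⇒ `τ_int(f_c) ≥ 2 Var(f_c)/((n+1) δ²) − ½` (`Var(f_c)/(n+1) → χ` as `c → ∞`:
at least `2χ/δ² − ½` updates). -/
theorem hmcPhi4_oneStep_tauInt_ge_clipMag {lam : ℝ} (hlam : 0 < lam)
    (J : Fin (n + 1) → Fin (n + 1) → ℝ) (δ c : ℝ)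
    (hs : Summable fun k => (∫ φ, (max (-c) (min c (∑ y, φ y))
          - gibbsExpect J lam (fun ψ => max (-c) (min c (∑ y, ψ y))))
        * ((hmcOpPhi4 J lam δ 1)^[k + 1] (fun ψ => max (-c) (min c (∑ y, ψ y))
          - gibbsExpect J lam (fun ψ => max (-c) (min c (∑ y, ψ y))))) φ * gibbsWeight J lam φ)
        / ∫ φ, (max (-c) (min c (∑ y, φ y))
          - gibbsExpect J lam (fun ψ => max (-c) (min c (∑ y, ψ y)))) ^ 2 * gibbsWeight J lam φ)
    (hρ : (∫ φ, (max (-c) (min c (∑ y, φ y))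
          - gibbsExpect J lam (fun ψ => max (-c) (min c (∑ y, ψ y))))
        * hmcOpPhi4 J lam δ 1 (fun ψ => max (-c) (min c (∑ y, ψ y))
          - gibbsExpect J lam (fun ψ => max (-c) (min c (∑ y, ψ y)))) φ * gibbsWeight J lam φ)
        / (∫ φ, (max (-c) (min c (∑ y, φ y))
          - gibbsExpect J lam (fun ψ => max (-c) (min c (∑ y, ψ y)))) ^ 2 * gibbsWeight J lam φ)
        < 1) :
    2 * gibbsExpect J lam (fun φ => (max (-c) (min c (∑ y, φ y))
          - gibbsExpect J lam (fun ψ => max (-c) (min c (∑ y, ψ y)))) ^ 2) / (((n : ℝ) + 1) * δ ^ 2)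
        - 1 / 2
      ≤ tauInt (fun k => (∫ φ, (max (-c) (min c (∑ y, φ y))
          - gibbsExpect J lam (fun ψ => max (-c) (min c (∑ y, ψ y))))
        * ((hmcOpPhi4 J lam δ 1)^[k] (fun ψ => max (-c) (min c (∑ y, ψ y))
          - gibbsExpect J lam (fun ψ => max (-c) (min c (∑ y, ψ y))))) φ * gibbsWeight J lam φ)
        / ∫ φ, (max (-c) (min c (∑ y, φ y))
          - gibbsExpect J lam (fun ψ => max (-c) (min c (∑ y, ψ y)))) ^ 2 * gibbsWeight J lam φ) :=
  hmcPhi4_oneStep_tauInt_ge hlam J δ (clipMag_bddObs c) (fun ψ φ => clipMag_lipschitz_global c ψ φ)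
    hs hρ

end OneStep

end Summit.Ventures.LatticeQCDFlow.Exactness
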